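import Summits.HodgeConjecture.CorCM.MultiFieldWeilAnyTwoSimpleThreefolds
import Summits.HodgeConjecture.CorCM.MultiFieldWeilCurveTimesSimpleThreefold
import Summits.HodgeConjecture.CorCM.CMCurvesAndSimpleSurfacesHodge
import Summits.HodgeConjecture.CorCM.SimpleCMSurfaceTimesThreefoldHodge
import HarnessLib

/-!
# MULTI-FIELD WEIL ENGINE — ANY TWO SIMPLE CM ABELIAN VARIETIES OF DIMENSION `≤ 3`: the Hodge conjecture for EVERY product of copies `A₀^a × A₁^b`,
# given ONLY Markman's fourfold theorem (Moonen–Zarhin's world of dimension `≤ 5`, all powers, and the sixfold `T₀ × T₁`)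

Cell `pub-hodgecm2` (COR-CM), seat b30 gen 31 (2026-08-24); count-neutral own lane MULTI-FIELD WEIL ENGINE (stem `MultiFieldWeil*`), the roof over
`CorCM/MultiFieldWeilAnyTwoSimpleThreefolds.lean` (G5) and `CorCM/MultiFieldWeilCurveTimesSimpleThreefold.lean` (G6).  Theorems only; no definition, no named fact, no
`sorry`.  HONEST FRAMING: conditional on the displayed Markman fourfold binder only, and only in the two configurations with Weil classes; `HC_CM` is NOT proved
and not asserted.

THE STATEMENT (**`hodgeConjectureFor_biproduct_comp_vec_of_any_two_simple_dim_le_three_of_markman`**).  `A₀ ⊨ (K₀; Φ₀)`, `A₁ ⊨ (K₁; Φ₁)` SIMPLE complex abelian varieties of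
CM type of dimension `≤ 3` (CM elliptic curves, simple CM surfaces, simple CM threefolds; realisations read on `H¹`) — NOTHING else assumed.  Then for EVERY
`κ : Fin N → Fin 2` the Hodge conjecture holds for `⨁_j ![A₀, A₁] (κ j)` — every `A₀^a × A₁^b` — GIVEN ONLY `Markman2025_weilClasses_algebraic_abelianFourfold`; likewise
for `A₀ × A₁`, for everything such a product dominates, and for all powers of anything isogenous to such a product.  By `[K_i : ℚ] = 2 dim A_i ∈ {2, 4, 6}`:
* `A₀ ∼ A₁`: a power of one CM variety of dimension `≤ 3` — UNCONDITIONAL (b16, Moonen–Zarhin (5.2));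
* degrees `{2, 4}` only (curves and simple surfaces, non-isogenous): UNCONDITIONAL — b16's `CMCurvesAndSurfaces.hodgeConjectureFor_prod_curves_simpleSurfaces_of_closures`
  (its only obstruction, three surfaces in one dihedral closure, needs three factors);
* degrees `{4, 6}`: UNCONDITIONAL — b16's `hodgeConjectureFor_prod_simpleSurface_simpleThreefold` (the Galois closure of a sextic CM field contains no cyclic or dihedral
  quartic CM field);
* degrees `{2, 6}`: G6 `hodgeConjectureFor_biproduct_comp_vec_of_cmCurve_simpleThreefold_of_markman` (Moonen–Zarhin Thm. (0.1) (1), (4), case (a) — `E × T` is a fourfold: Markman only when `k ↪ K`);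
* degrees `{6, 6}`: G5 `hodgeConjectureFor_biproduct_comp_vec_of_any_two_simpleThreefolds_of_markman` (Markman only when the fields share an imaginary quadratic field).
RELATION TO THE TREE.  Seat b16's `hodgeConjectureFor_prod_simple_dim_le_three` (`CorCM/SimpleCMPairsDimLeThreeHodge.lean`) is the UNCONDITIONAL pair theorem under the
hypothesis «the two CM fields share no imaginary quadratic subfield» (and `exists_exceptional_prod_simple_dim_le_three_iff` shows that hypothesis is necessary for
`B• = D•`); the present file REMOVES that hypothesis at the price of Markman's fourfold theorem — the shared-field configurations `(E, T)`, `(T₀, T₁)` are exactly where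
the Weil classes live — and is assembled from the same census files plus G5/G6; nothing of b16's is restated.

[cite: MoonenZarhin1999LowDim, Thm. (0.1) (1), (4) with case (a), Thm. (0.2), §3 (3.1), (3.9), §5 (5.2)] [cite: Markman2025SurveySecant, Thm. 1.2] [cite: Gordon1999HodgeAVSurvey, §3 Theorem, 7.5–7.7]
[cite: MumfordAV1970, §19 Thm. 1 and p. 169]

## References
* [MoonenZarhin1999LowDim] B. Moonen, Yu. Zarhin, Math. Ann. 315 (1999) 711–733.  [Markman2025SurveySecant] E. Markman, arXiv:2509.23403, Thm. 1.2.
  [Gordon1999HodgeAVSurvey] B. B. Gordon, *A survey of the Hodge conjecture for abelian varieties*.  [MumfordAV1970] D. Mumford, *Abelian Varieties*, §19.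
-/

noncomputable section

open CategoryTheory CategoryTheory.Limits NumberField

namespace Summit.HodgeConjecture.CorCM.MultiFieldWeil

open Literature.AlgebraicGeometry Literature.AlgebraicGeometry.Motives Literature.AlgebraicGeometry.HodgeTheory
open Literature.AlgebraicGeometry.ComplexMultiplication (IsCMTypeRealisation)
open Literature.AlgebraicTopology.SingularHomology
open Literature.NumberTheory.ComplexMultiplication
open Literature.AlgebraicGeometry.Milne1999 (IsOfCMType)

open scoped Classical

section AnyTwo

variable {K₀ K₁ : Type} [Field K₀] [NumberField K₀] [IsCMField K₀] [Field K₁] [NumberField K₁] [IsCMField K₁] {N : ℕ}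
  {A₀ A₁ : AbelianVariety ℂ} {Φ₀ : CMType K₀} {Φ₁ : CMType K₁}
  {ι₀ : 𝓞 K₀ →+* End A₀} {θ₀ : K₀ →+* Module.End ℂ (complexBetti A₀.X 1)}
  {ι₁ : 𝓞 K₁ →+* End A₁} {θ₁ : K₁ →+* Module.End ℂ (complexBetti A₁.X 1)}

omit [NumberField K₀] [IsCMField K₀] [NumberField K₁] [IsCMField K₁] in
/-- Swapping the two slots: `⨁_j ![A₁, A₀] (swap (κ j)) = ⨁_j ![A₀, A₁] (κ j)` (the families agree pointwise). [folklore] -/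
theorem biproduct_vec_two_swap (κ : Fin N → Fin 2) :
    (fun j => (![A₁, A₀] : Fin 2 → AbelianVariety ℂ) (Equiv.swap (0 : Fin 2) 1 (κ j))) = fun j => (![A₀, A₁] : Fin 2 → AbelianVariety ℂ) (κ j) := by
  funext j
  generalize κ j = c
  fin_cases c
  · rfl
  · rfl

omit [IsCMField K₀] [IsCMField K₁] in
/-- **ISOGENOUS case in dimension `≤ 3` (unconditional)**: every product of copies of `A₀ ∼ A₁` is an isogeny factor of a power of the CM variety `A₀` of dimension `≤ 3`.
[cite: MoonenZarhin1999LowDim, §5 (5.2)] [cite: Gordon1999HodgeAVSurvey, 7.5 and 7.6.1] [cite: MumfordAV1970, §19] -/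
theorem hodgeConjectureFor_biproduct_comp_vec_of_isIsogenous_dim_le_three (hA₀ : IsCMTypeRealisation Φ₀ A₀ ι₀ θ₀) (h3₀ : A₀.dim ≤ 3)
    (hiso : AbelianVariety.IsIsogenous A₀ A₁) (κ : Fin N → Fin 2) :
    HodgeConjectureFor (⨁ fun j => (![A₀, A₁] : Fin 2 → AbelianVariety ℂ) (κ j)).dim (⨁ fun j => (![A₀, A₁] : Fin 2 → AbelianVariety ℂ) (κ j)).X := by
  have hcm : IsOfCMType A₀ := isOfCMType_of_isCMTypeRealisation hA₀
  have hXB : AbelianVariety.IsIsogenous (⨁ fun j => (![A₀, A₁] : Fin 2 → AbelianVariety ℂ) (κ j)) (⨁ fun _ : Fin N => A₀) := by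
    refine AbelianVariety.IsIsogenous.biproduct fun j => ?_
    show AbelianVariety.IsIsogenous ((![A₀, A₁] : Fin 2 → AbelianVariety ℂ) (κ j)) A₀
    generalize κ j = c
    fin_cases c
    · exact AbelianVariety.IsIsogenous.refl A₀
    · exact hiso.symm'
  obtain ⟨M, hdom⟩ := exists_avDominatedBy_biproduct_slots_powSucc (A' := fun _ : Unit => A₀) (cls := fun _ : Fin 1 => ()) (X := A₀)
    (fun u => ⟨0, by cases u; rfl⟩) (Literature.AlgebraicGeometry.Pohlmann1968.isIsogenous_powSucc_biproduct A₀ 0) (fun _ : Fin N => ())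
  exact hodgeConjectureFor_of_avDominatedBy_powSucc_of_isOfCMType_of_dim_le_three hcm h3₀ (Domination.AVDominatedBy.of_isIsogenous hXB hdom)

/-- **MAIN THEOREM — ANY TWO SIMPLE CM ABELIAN VARIETIES OF DIMENSION `≤ 3`, given ONLY Markman's fourfold theorem.**  `A₀ ⊨ (K₀; Φ₀)`, `A₁ ⊨ (K₁; Φ₁)` SIMPLE, of
CM type, `dim ≤ 3` — nothing else assumed.  Then for every `κ : Fin N → Fin 2` (every `A₀^a × A₁^b`) the Hodge conjecture holds for `⨁_j ![A₀, A₁] (κ j)`, GIVEN ONLY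
`Markman2025_weilClasses_algebraic_abelianFourfold` — needed only for a CM elliptic curve against a simple CM threefold whose field contains the curve's field, and for two
simple CM threefolds whose fields share an imaginary quadratic field; every other configuration is unconditional (Moonen–Zarhin).  `HC_CM` is NOT asserted.
[cite: MoonenZarhin1999LowDim, Thm. (0.1) (1), (4) with case (a), §3 (3.1), §5 (5.2)] [cite: Markman2025SurveySecant, Thm. 1.2] [cite: Gordon1999HodgeAVSurvey, §3 Theorem, 7.5–7.7] -/
theorem hodgeConjectureFor_biproduct_comp_vec_of_any_two_simple_dim_le_three_of_markman (hW4 : Markman2025_weilClasses_algebraic_abelianFourfold)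
    (hA₀ : IsCMTypeRealisation Φ₀ A₀ ι₀ θ₀) (hA₁ : IsCMTypeRealisation Φ₁ A₁ ι₁ θ₁) (hS₀ : A₀.IsSimple) (hS₁ : A₁.IsSimple) (h3₀ : A₀.dim ≤ 3) (h3₁ : A₁.dim ≤ 3)
    (κ : Fin N → Fin 2) :
    HodgeConjectureFor (⨁ fun j => (![A₀, A₁] : Fin 2 → AbelianVariety ℂ) (κ j)).dim (⨁ fun j => (![A₀, A₁] : Fin 2 → AbelianVariety ℂ) (κ j)).X := by
  by_cases hiso : AbelianVariety.IsIsogenous A₀ A₁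
  · exact hodgeConjectureFor_biproduct_comp_vec_of_isIsogenous_dim_le_three hA₀ h3₀ hiso κ
  -- the degrees `[K_i : ℚ] = 2 dim A_i ∈ {2, 4, 6}`
  have hd₀ : Module.finrank ℚ K₀ = 2 ∨ Module.finrank ℚ K₀ = 4 ∨ Module.finrank ℚ K₀ = 6 := by
    have h := Literature.AlgebraicGeometry.Pohlmann1968.finrank_eq_two_mul_dim_of_isCMTypeRealisation hA₀
    have hp : 0 < Module.finrank ℚ K₀ := Module.finrank_pos
    interval_cases hd : A₀.dim <;> omega
  have hd₁ : Module.finrank ℚ K₁ = 2 ∨ Module.finrank ℚ K₁ = 4 ∨ Module.finrank ℚ K₁ = 6 := by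
    have h := Literature.AlgebraicGeometry.Pohlmann1968.finrank_eq_two_mul_dim_of_isCMTypeRealisation hA₁
    have hp : 0 < Module.finrank ℚ K₁ := Module.finrank_pos
    interval_cases hd : A₁.dim <;> omega
  -- the family `(K₀, K₁)` over `Fin 2` for the census theorems of seat b16 (all identifications definitional)
  let K : Fin 2 → Type := Fin.cons K₀ (Fin.cons K₁ finZeroElim)
  letI instF : ∀ j, Field (K j) := Fin.cons ‹Field K₀› (Fin.cons ‹Field K₁› finZeroElim)
  letI instN : ∀ j, NumberField (K j) := Fin.cons ‹NumberField K₀› (Fin.cons ‹NumberField K₁› finZeroElim)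
  haveI instC : ∀ j, IsCMField (K j) := Fin.cons ‹IsCMField K₀› (Fin.cons ‹IsCMField K₁› finZeroElim)
  let Φ : ∀ j : Fin 2, CMType (K j) := Fin.cons Φ₀ (Fin.cons Φ₁ finZeroElim)
  let ι : ∀ j : Fin 2, 𝓞 (K j) →+* End ((![A₀, A₁] : Fin 2 → AbelianVariety ℂ) j) := Fin.cons ι₀ (Fin.cons ι₁ finZeroElim)
  let θ : ∀ j : Fin 2, K j →+* Module.End ℂ (complexBetti ((![A₀, A₁] : Fin 2 → AbelianVariety ℂ) j).X 1) := Fin.cons θ₀ (Fin.cons θ₁ finZeroElim)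
  have hA : ∀ j, IsCMTypeRealisation (Φ j) ((![A₀, A₁] : Fin 2 → AbelianVariety ℂ) j) (ι j) (θ j) := Fin.cons hA₀ (Fin.cons hA₁ finZeroElim)
  have hS : ∀ j, ((![A₀, A₁] : Fin 2 → AbelianVariety ℂ) j).IsSimple := Fin.forall_fin_two.2 ⟨hS₀, hS₁⟩
  have hniso : ∀ i j : Fin 2, i ≠ j → ¬ AbelianVariety.IsIsogenous ((![A₀, A₁] : Fin 2 → AbelianVariety ℂ) i) ((![A₀, A₁] : Fin 2 → AbelianVariety ℂ) j) := by
    intro i j hij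
    fin_cases i <;> fin_cases j
    · exact absurd rfl hij
    · exact hiso
    · exact fun h => hiso h.symm'
    · exact absurd rfl hij
  have hI : ∀ j : Fin 2, j = 0 ∨ j = 1 := fun j => by fin_cases j <;> simp
  -- degrees `{2, 4}` only: curves and simple surfaces (b16, unconditional)
  have low : (Module.finrank ℚ K₀ = 2 ∨ Module.finrank ℚ K₀ = 4) → (Module.finrank ℚ K₁ = 2 ∨ Module.finrank ℚ K₁ = 4) →
      HodgeConjectureFor (⨁ fun j => (![A₀, A₁] : Fin 2 → AbelianVariety ℂ) (κ j)).dim (⨁ fun j => (![A₀, A₁] : Fin 2 → AbelianVariety ℂ) (κ j)).X := by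
    intro h₀ h₁
    have hdim : ∀ j : Fin 2, Module.finrank ℚ (K j) = 2 ∨ Module.finrank ℚ (K j) = 4 := Fin.forall_fin_two.2 ⟨h₀, h₁⟩
    exact (CMCurvesAndSurfaces.hodgeConjectureFor_prod_curves_simpleSurfaces_of_closures (K := K) (A := (![A₀, A₁] : Fin 2 → AbelianVariety ℂ))
      (Φ := Φ) (ι := ι) (θ := θ) hdim hA hS hniso (fun i j k hij hjk hik _ => by fin_cases i <;> fin_cases j <;> fin_cases k <;> simp_all) κ).1
  rcases hd₀ with h2₀ | h4₀ | h6₀ <;> rcases hd₁ with h2₁ | h4₁ | h6₁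
  · exact low (Or.inl h2₀) (Or.inl h2₁)
  · exact low (Or.inl h2₀) (Or.inr h4₁)
  · -- `E × T`
    exact hodgeConjectureFor_biproduct_comp_vec_of_cmCurve_simpleThreefold_of_markman hW4 h2₀ h6₁ hA₀ hA₁ hS₁ κ
  · exact low (Or.inr h4₀) (Or.inl h2₁)
  · exact low (Or.inr h4₀) (Or.inr h4₁)
  · -- `S × T` (b16, unconditional)
    exact (hodgeConjectureFor_prod_simpleSurface_simpleThreefold (K := K) (A := (![A₀, A₁] : Fin 2 → AbelianVariety ℂ)) (Φ := Φ) (ι := ι) (θ := θ)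
      (i₀ := (0 : Fin 2)) (i₁ := (1 : Fin 2)) Fin.zero_ne_one hI h4₀ h6₁ hA hS₀ hS₁ κ).1
  · -- `T × E`: G6 with the slots swapped
    have h := hodgeConjectureFor_biproduct_comp_vec_of_cmCurve_simpleThreefold_of_markman hW4 h2₁ h6₀ hA₁ hA₀ hS₀ (fun j => Equiv.swap (0 : Fin 2) 1 (κ j))
    rw [biproduct_vec_two_swap κ] at h
    exact h
  · -- `T × S` (b16, unconditional, slots `i₀ = 1`, `i₁ = 0`)
    exact (hodgeConjectureFor_prod_simpleSurface_simpleThreefold (K := K) (A := (![A₀, A₁] : Fin 2 → AbelianVariety ℂ)) (Φ := Φ) (ι := ι) (θ := θ)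
      (i₀ := (1 : Fin 2)) (i₁ := (0 : Fin 2)) Fin.zero_ne_one.symm (fun j => (hI j).symm) h4₁ h6₀ hA hS₁ hS₀ κ).1
  · -- `T₀ × T₁`
    exact hodgeConjectureFor_biproduct_comp_vec_of_any_two_simpleThreefolds_of_markman hW4 h6₀ h6₁ hA₀ hA₁ hS₀ hS₁ κ

/-- **`A₀ × A₁` itself**, for ANY two simple CM abelian varieties of dimension `≤ 3`, given only Markman's fourfold theorem. [cite: MoonenZarhin1999LowDim, Thm. (0.1), (0.2)]
[cite: Markman2025SurveySecant, Thm. 1.2] -/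
theorem hodgeConjectureFor_prod_of_any_two_simple_dim_le_three_of_markman (hW4 : Markman2025_weilClasses_algebraic_abelianFourfold)
    (hA₀ : IsCMTypeRealisation Φ₀ A₀ ι₀ θ₀) (hA₁ : IsCMTypeRealisation Φ₁ A₁ ι₁ θ₁) (hS₀ : A₀.IsSimple) (hS₁ : A₁.IsSimple) (h3₀ : A₀.dim ≤ 3) (h3₁ : A₁.dim ≤ 3) :
    HodgeConjectureFor (A₀.prod A₁).dim (A₀.prod A₁).X :=
  PairWeights.hodgeConjectureFor_prod_of_biproduct (A := (![A₀, A₁] : Fin 2 → AbelianVariety ℂ))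
    (hodgeConjectureFor_biproduct_comp_vec_of_any_two_simple_dim_le_three_of_markman hW4 hA₀ hA₁ hS₀ hS₁ h3₀ h3₁ (id : Fin 2 → Fin 2))

/-- **Dominated form** (everything isogenous to some `A₀^a × A₁^b`, every abelian subvariety or quotient of one). [cite: Markman2025SurveySecant, Thm. 1.2]
[cite: MumfordAV1970, §19 Thm. 1 and p. 169] -/
theorem hodgeConjectureFor_of_avDominatedBy_comp_vec_of_any_two_simple_dim_le_three_of_markman (hW4 : Markman2025_weilClasses_algebraic_abelianFourfold)
    (hA₀ : IsCMTypeRealisation Φ₀ A₀ ι₀ θ₀) (hA₁ : IsCMTypeRealisation Φ₁ A₁ ι₁ θ₁) (hS₀ : A₀.IsSimple) (hS₁ : A₁.IsSimple) (h3₀ : A₀.dim ≤ 3) (h3₁ : A₁.dim ≤ 3)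
    (κ : Fin N → Fin 2) {X : AbelianVariety ℂ} (hX : Domination.AVDominatedBy X (⨁ fun j => (![A₀, A₁] : Fin 2 → AbelianVariety ℂ) (κ j))) :
    HodgeConjectureFor X.dim X.X :=
  Domination.hodgeConjectureFor_of_avDominatedBy
    (hodgeConjectureFor_biproduct_comp_vec_of_any_two_simple_dim_le_three_of_markman hW4 hA₀ hA₁ hS₀ hS₁ h3₀ h3₁ κ) hX

/-- **Every abelian variety ISOGENOUS TO A PRODUCT OF COPIES of two simple CM abelian varieties of dimension `≤ 3`** (any finite index type).
[cite: Markman2025SurveySecant, Thm. 1.2] [cite: MumfordAV1970, §19] -/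
theorem hodgeConjectureFor_of_isIsogenous_biproduct_comp_of_any_two_simple_dim_le_three_of_markman (hW4 : Markman2025_weilClasses_algebraic_abelianFourfold)
    (hA₀ : IsCMTypeRealisation Φ₀ A₀ ι₀ θ₀) (hA₁ : IsCMTypeRealisation Φ₁ A₁ ι₁ θ₁) (hS₀ : A₀.IsSimple) (hS₁ : A₁.IsSimple) (h3₀ : A₀.dim ≤ 3) (h3₁ : A₁.dim ≤ 3)
    {J : Type} [Fintype J] (cls : J → Fin 2) {X : AbelianVariety ℂ}
    (hX : AbelianVariety.IsIsogenous X (⨁ fun j => (![A₀, A₁] : Fin 2 → AbelianVariety ℂ) (cls j))) : HodgeConjectureFor X.dim X.X := by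
  classical
  let ε : Fin (Fintype.card J) ≃ J := (Fintype.equivFin J).symm
  have e : (⨁ fun j => (![A₀, A₁] : Fin 2 → AbelianVariety ℂ) (cls j)) ≅ ⨁ fun l => (![A₀, A₁] : Fin 2 → AbelianVariety ℂ) (cls (ε l)) :=
    (biproduct.reindex ε fun j => (![A₀, A₁] : Fin 2 → AbelianVariety ℂ) (cls j)).symm
  exact hodgeConjectureFor_of_avDominatedBy_comp_vec_of_any_two_simple_dim_le_three_of_markman hW4 hA₀ hA₁ hS₀ hS₁ h3₀ h3₁ (fun l => cls (ε l))
    (Domination.AVDominatedBy.of_isIsogenous hX ((Domination.AVDominatedBy.refl _).of_iso_right e))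

/-- **… and ALL POWERS of such an abelian variety.** [cite: Markman2025SurveySecant, Thm. 1.2] [cite: Gordon1999HodgeAVSurvey, 7.6.1] [cite: MumfordAV1970, §19] -/
theorem hodgeConjectureFor_powSucc_of_isIsogenous_biproduct_comp_of_any_two_simple_dim_le_three_of_markman
    (hW4 : Markman2025_weilClasses_algebraic_abelianFourfold)
    (hA₀ : IsCMTypeRealisation Φ₀ A₀ ι₀ θ₀) (hA₁ : IsCMTypeRealisation Φ₁ A₁ ι₁ θ₁) (hS₀ : A₀.IsSimple) (hS₁ : A₁.IsSimple) (h3₀ : A₀.dim ≤ 3) (h3₁ : A₁.dim ≤ 3)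
    {J : Type} [Fintype J] (cls : J → Fin 2) {X : AbelianVariety ℂ}
    (hX : AbelianVariety.IsIsogenous X (⨁ fun j => (![A₀, A₁] : Fin 2 → AbelianVariety ℂ) (cls j))) (M : ℕ) :
    HodgeConjectureFor (X.powSucc M).dim (X.powSucc M).X := by
  obtain ⟨n, ρ, hdom⟩ := exists_avDominatedBy_powSucc_biproduct_slots_of_isIsogenous hX M
  exact hodgeConjectureFor_of_avDominatedBy_comp_vec_of_any_two_simple_dim_le_three_of_markman hW4 hA₀ hA₁ hS₀ hS₁ h3₀ h3₁ ρ hdom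

end AnyTwo

end Summit.HodgeConjecture.CorCM.MultiFieldWeil

end
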